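import Mathlib
import Literature.AlgebraicGeometry.Motives.Differentials
import Literature.AlgebraicGeometry.HodgeTheory.ComplexGysin
import Literature.AlgebraicGeometry.HodgeTheory.HodgeFiltration
import Literature.AlgebraicGeometry.HodgeTheory.HodgeConjecture
import Literature.Geometry.Kaehler.HolomorphicChartForms

/-!
# Sketch — crux-ideate `stmt-HodgeConjecture-13680` (`SquareHodgeOfSqrtTwo`), round 1, ideator 1

First lemmas of the crux idea cards.

* Card `dihedral-hecke-sqrt2` (√2 = ζ₈ + ζ₈⁻¹ as a Hecke operator of a dihedral cover):
  `hecke_identity` (on τ-invariants the transfer `p_* σ_* p^*` is `σ + σ⁻¹`, from the dihedral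
  relation `τσ = σ⁻¹τ`), `sqrtTwo_of_order_eight` (where `σ⁴ = −1`, `e := σ + σ⁻¹ = σ − σ³`
  satisfies `e² = 2`) and `secondHecke_vanishes`, all PROVED (in the commutative algebra `ℚ[σ^*]`); and the typed statement `IsogenyInvariance` (algebraicity of
  real multiplication is invariant under algebraic rational Hodge isometries = Buskin isogenies),
  stated over the route's own vocabulary.
* Card `frobenius-polynomial-serre-tate` (at an ordinary prime `e ≡ r(Frob)`):
  `CentraliserOfCyclic` (the commutant of a cyclic endomorphism `π` is `K[π]`, so an `e`
  commuting with Frobenius is a polynomial in Frobenius), stated.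
-/

namespace Summit.HodgeConjecture.HodgeConjecture.Cruxes.SquareHodgeOfSqrtTwo.IdeaSketch1

/-- **Card A, first lemma 1 (Hecke identity).** In a `ℚ[D_n]`-module, with `τσ = σ'τ`
(`σ' = σ⁻¹`), the transfer `(1 + τ) ∘ σ` restricted to the `τ`-invariants is `σ + σ'`:
geometrically `C_* = p_* σ_* p^* = σ^* + (σ⁻¹)^*` on `H²(X) = H²(X̃)^τ` (vGS §4.7). -/
theorem hecke_identity {V : Type*} [AddCommGroup V] [Module ℚ V] (σ σ' τ : V →ₗ[ℚ] V)
    (hrel : τ ∘ₗ σ = σ' ∘ₗ τ) (v : V) (hv : τ v = v) :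
    σ v + τ (σ v) = σ v + σ' v := by
  have h : τ (σ v) = σ' (τ v) := by
    simpa using LinearMap.congr_fun hrel v
  rw [h, hv]

/-- **Card A, first lemma 2 (√2 from order 8).** On the ζ₈-primitive part (where `σ⁴ = −1`,
so `σ⁻¹ = −σ³`) the Hecke operator `e = σ + σ⁻¹ = σ − σ³` satisfies `e² = 2`. -/
theorem sqrtTwo_of_order_eight {R : Type*} [CommRing R] (σ : R) (h : σ ^ 4 = -1) :
    (σ - σ ^ 3) ^ 2 = 2 := by
  linear_combination (σ ^ 2 - 2) * h

/-- On the same part the SECOND Hecke operator `C₂ = σ² + σ⁻² = σ² + (−σ³)²` acts by ZERO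
(`ζ₈² + ζ₈⁻² = 0`): the (2,2)-correspondence `C₂ ⊂ X × X` kills `T(X)` and `H^{2,0}`.
(Stated in the commutative algebra `ℚ[σ^*] ⊂ End H²(X̃,ℚ)`.) -/
theorem secondHecke_vanishes {R : Type*} [CommRing R] (σ : R) (h : σ ^ 4 = -1) :
    σ ^ 2 + (-σ ^ 3) ^ 2 = 0 := by
  linear_combination σ ^ 2 * h

open scoped Manifold
open Literature.AlgebraicGeometry.HodgeTheory Literature.AlgebraicGeometry.Motives
  Literature.AlgebraicTopology.SingularHomology CategoryTheory

/-- The route's unfolded `IsK3Surface`. -/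
def IsK3 (S : SchemeOver ℂ) : Prop :=
  IsSmoothProjective 2 S ∧ Subsingleton (structureSheafCohomology S.left 1) ∧
    ∃ (A : HodgeModel 2 S) (η : Literature.Geometry.Kaehler.MForm 𝓘(ℝ, A.model) A.carrier ℂ 2),
      Literature.Geometry.Kaehler.IsHolomorphicInCharts η ∧ ∀ x, η x ≠ 0

/-- `e : H²(S) → H²(S)` is the class of an algebraic self-correspondence of `S`
(verbatim the conclusion shape of the route's `RealMultiplicationSqrtTwoAlgebraic`). -/
def SelfCorrAlgebraic (μ : OrientationFamily) (S : SchemeOver ℂ) (hS : IsK3 S)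
    (e : complexBetti S (2 * 1) →ₗ[ℂ] complexBetti S (2 * 1)) : Prop :=
  ∃ γ ∈ algebraicClasses (MonoidalCategoryStruct.tensorObj S S) 2,
    ∀ x : complexBetti S (2 * 1), e x =
      complexGysin μ (IsSmoothProjective.tensor_holds hS.1 hS.1) hS.1
        (SemiCartesianMonoidalCategory.fst S S) (rfl : 2 * 1 + 2 * 2 + 2 * 2 = 2 * 1 + 2 * (2 + 2))
        (cupProduct (rfl : 2 * 1 + 2 * 2 = 2 * 1 + 2 * 2)
          (complexBetti.map (SemiCartesianMonoidalCategory.snd S S) (2 * 1) x) γ)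

/-- `φ : H²(S') → H²(S)` is the class of an algebraic correspondence on `S × S'`. -/
def CorrAlgebraic (μ : OrientationFamily) (S S' : SchemeOver ℂ) (hS : IsK3 S) (hS' : IsK3 S')
    (φ : complexBetti S' (2 * 1) →ₗ[ℂ] complexBetti S (2 * 1)) : Prop :=
  ∃ γ ∈ algebraicClasses (MonoidalCategoryStruct.tensorObj S S') 2,
    ∀ x : complexBetti S' (2 * 1), φ x =
      complexGysin μ (IsSmoothProjective.tensor_holds hS.1 hS'.1) hS.1
        (SemiCartesianMonoidalCategory.fst S S') (rfl : 2 * 1 + 2 * 2 + 2 * 2 = 2 * 1 + 2 * (2 + 2))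
        (cupProduct (rfl : 2 * 1 + 2 * 2 = 2 * 1 + 2 * 2)
          (complexBetti.map (SemiCartesianMonoidalCategory.snd S S') (2 * 1) x) γ)

/-- **Card A, typed first lemma (isogeny invariance of the crux).** If `φ : H²(S') ≃ H²(S)` and
its inverse are algebraic (e.g. a rational Hodge ISOMETRY between projective K3 surfaces and its
transpose — Buskin, route item `HodgeIsometryAlgebraic`), then real multiplication `e` on `S` is
algebraic iff its transport `φ⁻¹ ∘ e ∘ φ` on `S'` is: the algebraicity locus of `e` in the RM
Shimura variety is a union of isogeny classes (Hecke-saturated). Proof = composition of algebraic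
correspondences (the route's formal debt `CompCorr`), no research content. -/
def IsogenyInvariance : Prop :=
  ∀ (μ : OrientationFamily), μ.HasPoincareDuality → ∀ (S S' : SchemeOver ℂ) (hS : IsK3 S)
    (hS' : IsK3 S') (φ : complexBetti S' (2 * 1) ≃ₗ[ℂ] complexBetti S (2 * 1)),
    CorrAlgebraic μ S S' hS hS' φ.toLinearMap → CorrAlgebraic μ S' S hS' hS φ.symm.toLinearMap →
    ∀ e : complexBetti S (2 * 1) →ₗ[ℂ] complexBetti S (2 * 1),
      SelfCorrAlgebraic μ S hS e →
        SelfCorrAlgebraic μ S' hS' (φ.symm.toLinearMap ∘ₗ e ∘ₗ φ.toLinearMap)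

/-- **Card B, first lemma (centraliser of a cyclic endomorphism).** If `π` has a cyclic vector
then everything commuting with `π` is a polynomial in `π`.  Applied with `K = ℚ_ℓ`,
`V = T(S_𝔭)_ℓ`, `π = Frob_𝔭` (cyclic on the transcendental part of an ORDINARY K3, Zarhin) and
`e` the ℓ-adic realisation of the RM class: `e = r(Frob_𝔭)`. -/
def CentraliserOfCyclic : Prop :=
  ∀ (K V : Type) [Field K] [AddCommGroup V] [Module K V] [FiniteDimensional K V]
    (π e : Module.End K V),
    (∃ v : V, Submodule.span K (Set.range fun n : ℕ => (π ^ n) v) = ⊤) →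
    Commute π e → e ∈ Algebra.adjoin K ({π} : Set (Module.End K V))

/-- **Card B, sign lemma.** In a field containing a square root `s` of `2`, the only square roots
of `2` are `± s`; so once the Frobenius field `ℚ(π)` is a FIELD containing `√2` and the RM class is
known to lie in it (compatibility, Commelin), `e mod 𝔭 = ± s = r(π)` with `r ∈ ℚ[t]`. -/
theorem sqrt_two_signs {L : Type*} [Field L] (s e : L) (hs : s ^ 2 = 2) (he : e ^ 2 = 2) :
    e = s ∨ e = -s := by
  have h : (e - s) * (e + s) = 0 := by
    have : (e - s) * (e + s) = e ^ 2 - s ^ 2 := by ring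
    rw [this, hs, he, sub_self]
  rcases mul_eq_zero.mp h with h1 | h1
  · left; exact sub_eq_zero.mp h1
  · right; exact eq_neg_of_add_eq_zero_left h1

end Summit.HodgeConjecture.HodgeConjecture.Cruxes.SquareHodgeOfSqrtTwo.IdeaSketch1
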